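import Summits.CriticalPhenomena.SAWScalingLimit.Theorems.SAWTensorRGRestrictionOfLimitRadoLoop
import Summits.CriticalPhenomena.SAWScalingLimit.Theorems.SAWTensorRGRestrictionOfLimitSqueezeBite
import HarnessLib

/-!
# Radó squeezes, part 11: the squeezed domain at a fixed level

Support file (`--supports stmt-CriticalPhenomena-0773`, towards the registered stub `stub_radoSqueezeFamily`,
geometry F′ of the line `birth` for the crux `RestrictionOfLimit`). Pure plane topology.

At level `η ∈ (0, 1/4]` with a finite set `S` of treated representatives, the BITE of index `n ∈ S` is the chart
image `(d n).G '' {‖z‖ ≤ 1, η ≤ im z}` of the model bite; the squeezed domain is `D` minus the bites. By the bite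
lemma of the tree (`exists_dobrushin_carrier_eq_diff_biUnion`, Newman's cross-cut theorem) it carries a Dobrushin
domain with the marked points of `D`; its frontier contains the range of the loop of part 10 (periodised from the
window), hence equals it (a Jordan curve contains no proper Jordan sub-curve, part 7), so the squeezed domain is a
Dobrushin domain WITH BOUNDARY LOOP `loopγ η S` and the marks of `D'` (`exists_level`).

Axioms `propext`, `Classical.choice`, `Quot.sound`.
-/

noncomputable section

open Set Filter Topology Metric Complex
open Literature.Topology.PlaneTopology Literature.Probability.RandomPlanarGeometry
open scoped Classical

namespace Summit.CriticalPhenomena.SAWScalingLimit.Theorems.RestrictionOfLimit.Birth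

section Level

variable {D D' : DobrushinDomain} {F : Set ℝ} (xs : ℕ → ℝ)
  (d : ∀ n : ℕ, xs n ∈ F ∧ xs n ∈ Ioo (D'.mark 0) (D'.mark 0 + 1) → DefectData D D' F (xs n))
  (hex : ∀ y : ℝ, y ∈ F ∧ y ∈ Ioo (D'.mark 0) (D'.mark 0 + 1) →
    ∃ n : ℕ, (xs n ∈ F ∧ xs n ∈ Ioo (D'.mark 0) (D'.mark 0 + 1)) ∧ xs n ∈ connectedComponentIn F y)

/-- The **bite** of index `n` at level `η`: the chart image of the model bite `{‖z‖ ≤ 1, η ≤ im z}` (empty for a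
bad index). [folklore] -/
def bite (η : ℝ) (n : ℕ) : Set ℂ :=
  if h : xs n ∈ F ∧ xs n ∈ Ioo (D'.mark 0) (D'.mark 0 + 1) then (d n h).G '' {z : ℂ | ‖z‖ ≤ 1 ∧ η ≤ z.im}
  else ∅

variable (hF : F = {θ : ℝ | D'.boundary θ ∈ D.carrier}) (hsub : D'.carrier ⊆ D.carrier)
  (h0 : D'.pt 0 = D.pt 0) (h1 : D'.pt 1 = D.pt 1)

/-! ### Bites -/

/-- The bite of a good index. [folklore] -/
theorem bite_eq (η : ℝ) {n : ℕ} (h : xs n ∈ F ∧ xs n ∈ Ioo (D'.mark 0) (D'.mark 0 + 1)) :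
    bite xs d η n = (d n h).G '' {z : ℂ | ‖z‖ ≤ 1 ∧ η ≤ z.im} := by
  unfold bite; rw [dif_pos h]

/-- The model bite is compact. [folklore] -/
theorem isCompact_modelBite (η : ℝ) : IsCompact {z : ℂ | ‖z‖ ≤ 1 ∧ η ≤ z.im} := by
  have : {z : ℂ | ‖z‖ ≤ 1 ∧ η ≤ z.im} = closedBall (0 : ℂ) 1 ∩ {z : ℂ | η ≤ z.im} := by
    ext z; simp
  rw [this]
  exact (isCompact_closedBall 0 1).inter_right (isClosed_le continuous_const continuous_im)

include hF hsub h0 h1 in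
/-- **Points of a bite**: closed set, inside `closure U ∖ (closure D' ∪ {P, Q})`; a point of the bite in `D` is
the chart image of a model point strictly inside the disc. [folklore] -/
theorem bite_facts {η : ℝ} (hη0 : 0 < η) {n : ℕ} (h : xs n ∈ F ∧ xs n ∈ Ioo (D'.mark 0) (D'.mark 0 + 1)) :
    IsClosed (bite xs d η n) ∧ bite xs d η n ⊆ closure (d n h).U ∧
      (∀ w ∈ bite xs d η n, w ∉ closure D'.carrier ∧
        w ≠ D'.boundary (sInf (connectedComponentIn F (xs n))) ∧
        w ≠ D'.boundary (sSup (connectedComponentIn F (xs n)))) := by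
  rw [bite_eq xs d η h]
  set e := d n h
  refine ⟨((isCompact_modelBite η).image e.G.continuous).isClosed, ?_, ?_⟩
  · rintro _ ⟨z, hz, rfl⟩
    exact e.G_mem_closure hz.1 (hη0.le.trans hz.2)
  · rintro _ ⟨z, ⟨hz1, hzη⟩, rfl⟩
    have hpos : 0 < z.im := hη0.trans_le hzη
    obtain ⟨-, -, hPD, hQD, -⟩ := free_endpoints hF hsub h0 h1 h.1 h.2
    rcases hz1.lt_or_eq with hlt | heq
    · have hU : e.G z ∈ e.U := e.G_mem_U hlt hpos
      refine ⟨fun hcl ↦ ?_, fun hP ↦ hPD (hP ▸ e.U_subset hU), fun hQ ↦ hQD (hQ ▸ e.U_subset hU)⟩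
      have : e.G z ∈ e.U ∩ closure D'.carrier := ⟨hU, hcl⟩
      rw [e.U_inter_closure] at this
      exact this
    · obtain ⟨v, hv, hvG⟩ := e.G_semicircle heq hpos
      obtain ⟨hP, hQ, hcl, -⟩ := e.beta_open_facts hF hsub h0 h1 h.1 h.2 hv
      rw [hvG]
      exact ⟨hcl, hP, hQ⟩

include hF hsub h0 h1 in
/-- **Bites of distinct representatives are disjoint.** [folklore] -/
theorem bite_disjoint {η : ℝ} (hη0 : 0 < η) {n m : ℕ}
    (hn : (xs n ∈ F ∧ xs n ∈ Ioo (D'.mark 0) (D'.mark 0 + 1)) ∧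
      ∀ k < n, xs k ∈ F ∧ xs k ∈ Ioo (D'.mark 0) (D'.mark 0 + 1) →
        connectedComponentIn F (xs k) ≠ connectedComponentIn F (xs n))
    (hm : (xs m ∈ F ∧ xs m ∈ Ioo (D'.mark 0) (D'.mark 0 + 1)) ∧
      ∀ k < m, xs k ∈ F ∧ xs k ∈ Ioo (D'.mark 0) (D'.mark 0 + 1) →
        connectedComponentIn F (xs k) ≠ connectedComponentIn F (xs m))
    (hnm : n ≠ m) : Disjoint (bite xs d η n) (bite xs d η m) := by
  obtain ⟨-, hsubn, hfn⟩ := bite_facts xs d hF hsub h0 h1 hη0 hn.1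
  obtain ⟨-, hsubm, -⟩ := bite_facts xs d hF hsub h0 h1 hη0 hm.1
  refine Set.disjoint_left.2 fun w hwn hwm ↦ ?_
  have hmem := (d n hn.1).closure_inter hF hsub h0 h1 hn.1.1 hn.1.2 hm.1.1 hm.1.2
    (rep_disjoint_components xs hn hm hnm) (d m hm.1) ⟨hsubn hwn, hsubm hwm⟩
  obtain ⟨-, hP, hQ⟩ := hfn w hwn
  rcases hmem with h | h
  · exact hP h
  · exact hQ h

/-! ### The squeezed domain carries a Dobrushin domain (the bite lemma) -/

include hF hsub h0 h1 in
/-- **The bite lemma applied at level `η`**: `D` minus the bites of a finite set of representatives carries a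
Dobrushin domain with the marked points of `D`. [cite: Newman1939, Ch. V §11] -/
theorem exists_biteDomain {η : ℝ} (hη0 : 0 < η) (hη : η ≤ 1 / 4) (S : Finset ℕ)
    (hS : ∀ n ∈ S, (xs n ∈ F ∧ xs n ∈ Ioo (D'.mark 0) (D'.mark 0 + 1)) ∧
      ∀ k < n, xs k ∈ F ∧ xs k ∈ Ioo (D'.mark 0) (D'.mark 0 + 1) →
        connectedComponentIn F (xs k) ≠ connectedComponentIn F (xs n)) :
    ∃ E : DobrushinDomain, E.carrier = D.carrier \ ⋃ n ∈ S, bite xs d η n ∧ E.pt 0 = D.pt 0 ∧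
      E.pt 1 = D.pt 1 := by
  classical
  have hη1 : η < 1 := by linarith
  set c : ℂ := ((Real.sqrt (1 - η ^ 2) : ℝ) : ℂ) + (η : ℂ) * I with hc
  set c' : ℂ := ((-Real.sqrt (1 - η ^ 2) : ℝ) : ℂ) + (η : ℂ) * I with hc'
  have hchord := isSimpleArc_chord hη0 hη1
  have hc1 : ‖c‖ = 1 ∧ c.im = η := by
    refine ⟨?_, by simp [hc]⟩
    rw [hc, norm_add_mul_I, Real.sq_sqrt (by nlinarith), sub_add_cancel, Real.sqrt_one]
  have hc'1 : ‖c'‖ = 1 ∧ c'.im = η := by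
    refine ⟨?_, by simp [hc']⟩
    rw [hc', norm_add_mul_I, neg_sq, Real.sq_sqrt (by nlinarith), sub_add_cancel, Real.sqrt_one]
  -- the data of the bite lemma
  set T : ℕ → Set ℂ := fun n ↦ bite xs d η n with hT
  set L : ℕ → Set ℂ := fun n ↦ if h : xs n ∈ F ∧ xs n ∈ Ioo (D'.mark 0) (D'.mark 0 + 1) then
    (d n h).G '' {z : ℂ | ‖z‖ ≤ 1 ∧ z.im = η} else ∅ with hL
  set p : ℕ → ℂ := fun n ↦ if h : xs n ∈ F ∧ xs n ∈ Ioo (D'.mark 0) (D'.mark 0 + 1) then (d n h).G c else 0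
    with hp
  set q : ℕ → ℂ := fun n ↦ if h : xs n ∈ F ∧ xs n ∈ Ioo (D'.mark 0) (D'.mark 0 + 1) then (d n h).G c' else 0
    with hq
  have hab : ∀ i : Fin 2, D.pt i ∈ closure D'.carrier := fun i ↦ by
    fin_cases i
    · rw [show D.pt ((fun i => i) ⟨0, by norm_num⟩) = D'.pt 0 from h0.symm]
      exact frontier_subset_closure (D'.pt_mem_frontier 0)
    · rw [show D.pt ((fun i => i) ⟨1, by norm_num⟩) = D'.pt 1 from h1.symm]
      exact frontier_subset_closure (D'.pt_mem_frontier 1)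
  -- per-index verification
  have key : ∀ n ∈ S, IsClosed (T n) ∧ D.pt 0 ∉ T n ∧ D.pt 1 ∉ T n ∧ L n ⊆ T n ∧
      IsSimpleArc (L n) (p n) (q n) ∧ p n ∉ D.carrier ∧ q n ∉ D.carrier ∧
      p n ∈ closure ((D.carrier ∩ T n) \ L n) ∧ q n ∈ closure ((D.carrier ∩ T n) \ L n) ∧
      L n \ {p n, q n} ⊆ D.carrier ∧ IsOpen ((D.carrier ∩ T n) \ L n) ∧
      IsConnected ((D.carrier ∩ T n) \ L n) := by
    intro n hn
    obtain ⟨hgood, -⟩ := hS n hn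
    set e := d n hgood with he
    obtain ⟨hTc, hTsub, hTfacts⟩ := bite_facts xs d hF hsub h0 h1 hη0 hgood
    have hTn : T n = e.G '' {z : ℂ | ‖z‖ ≤ 1 ∧ η ≤ z.im} := by simp only [hT]; exact bite_eq xs d η hgood
    have hLn : L n = e.G '' {z : ℂ | ‖z‖ ≤ 1 ∧ z.im = η} := dif_pos hgood
    have hpn : p n = e.G c := dif_pos hgood
    have hqn : q n = e.G c' := dif_pos hgood
    -- the open bite
    have hB : (D.carrier ∩ T n) \ L n = e.G '' {z : ℂ | ‖z‖ < 1 ∧ η < z.im} := by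
      ext w
      constructor
      · rintro ⟨⟨hwD, hwT⟩, hwL⟩
        rw [hTn] at hwT
        obtain ⟨z, ⟨hz1, hzη⟩, rfl⟩ := hwT
        have hpos : 0 < z.im := hη0.trans_le hzη
        have hz1' : ‖z‖ < 1 := by
          refine lt_of_le_of_ne hz1 fun heq ↦ ?_
          obtain ⟨v, hv, hvG⟩ := e.G_semicircle heq hpos
          exact (e.beta_open_facts hF hsub h0 h1 hgood.1 hgood.2 hv).2.2.2.1 (hvG ▸ hwD)
        refine ⟨z, ⟨hz1', lt_of_le_of_ne hzη fun heq ↦ hwL ?_⟩, rfl⟩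
        rw [hLn]; exact ⟨z, ⟨hz1, heq.symm⟩, rfl⟩
      · rintro ⟨z, ⟨hz1, hzη⟩, rfl⟩
        have hpos : 0 < z.im := hη0.trans hzη
        refine ⟨⟨e.U_subset (e.G_mem_U hz1 hpos), ?_⟩, fun hwL ↦ ?_⟩
        · rw [hTn]; exact ⟨z, ⟨hz1.le, hzη.le⟩, rfl⟩
        · rw [hLn] at hwL
          obtain ⟨z', ⟨-, hz'η⟩, hzz'⟩ := hwL
          have := e.G.injective hzz'
          rw [this] at hz'η
          linarith
    obtain ⟨hBo, hBconv, hBne⟩ := isOpen_convex_openBite hη1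
    have hcorner : ∀ cc : ℂ, ‖cc‖ = 1 → cc.im = η →
        e.G cc ∉ D.carrier ∧ e.G cc ∈ closure ((D.carrier ∩ T n) \ L n) := fun cc hcc1 hccη ↦ by
      refine ⟨fun hD ↦ ?_, ?_⟩
      · obtain ⟨v, hv, hvG⟩ := e.G_semicircle hcc1 (hccη ▸ hη0)
        exact (e.beta_open_facts hF hsub h0 h1 hgood.1 hgood.2 hv).2.2.2.1 (hvG ▸ hD)
      · rw [hB]
        exact image_closure_subset_closure_image e.G.continuous
          ⟨cc, mem_closure_openBite hη0 hη1 hcc1.le hccη, rfl⟩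
    refine ⟨hTc, fun h ↦ (hTfacts _ h).1 (hab 0), fun h ↦ (hTfacts _ h).1 (hab 1), ?_, ?_, ?_, ?_, ?_, ?_, ?_,
      ?_, ?_⟩
    · rw [hLn, hTn]
      rintro _ ⟨z, ⟨hz1, hzη⟩, rfl⟩
      exact ⟨z, ⟨hz1, hzη.ge⟩, rfl⟩
    · rw [hLn, hpn, hqn]
      exact hchord.image e.G.continuous e.G.injective
    · rw [hpn]; exact (hcorner c hc1.1 hc1.2).1
    · rw [hqn]; exact (hcorner c' hc'1.1 hc'1.2).1
    · rw [hpn]; exact (hcorner c hc1.1 hc1.2).2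
    · rw [hqn]; exact (hcorner c' hc'1.1 hc'1.2).2
    · rw [hLn, hpn, hqn]
      rintro _ ⟨⟨z, ⟨hz1, hzη⟩, rfl⟩, hne⟩
      have hne' : z ≠ c ∧ z ≠ c' := by
        constructor <;> rintro rfl
        · exact hne (Or.inl rfl)
        · exact hne (Or.inr rfl)
      obtain ⟨hlt, hpos⟩ := chord_diff_corners_subset hη0 hz1 hzη hne'.1 hne'.2
      exact e.U_subset (e.G_mem_U hlt hpos)
    · rw [hB]; exact e.G.isOpenMap _ hBo
    · rw [hB]; exact ⟨hBne.image _, (hBconv.isPreconnected).image _ e.G.continuous.continuousOn⟩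
  obtain ⟨E, hE, hE0, hE1⟩ := exists_dobrushin_carrier_eq_diff_biUnion D S T L p q
    (fun n hn ↦ (key n hn).1) (fun n hn ↦ (key n hn).2.1) (fun n hn ↦ (key n hn).2.2.1)
    (fun n hn ↦ (key n hn).2.2.2.1) (fun n hn ↦ (key n hn).2.2.2.2.1) (fun n hn ↦ (key n hn).2.2.2.2.2.1)
    (fun n hn ↦ (key n hn).2.2.2.2.2.2.1) (fun n hn ↦ (key n hn).2.2.2.2.2.2.2.1)
    (fun n hn ↦ (key n hn).2.2.2.2.2.2.2.2.1) (fun n hn ↦ (key n hn).2.2.2.2.2.2.2.2.2.1)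
    (fun n hn ↦ (key n hn).2.2.2.2.2.2.2.2.2.2.1) (fun n hn ↦ (key n hn).2.2.2.2.2.2.2.2.2.2.2)
    (fun n hn m hm hnm ↦ bite_disjoint xs d hF hsub h0 h1 hη0 (hS n hn) (hS m hm) hnm)
  exact ⟨E, hE, hE0, hE1⟩

/-! ### The loop lies on the frontier of the squeezed domain -/

include hF hsub h0 h1 in
/-- **The squeezed domain contains `D'`**, and the defect side of an untreated representative, and the thin collar
of a treated one. [folklore] -/
theorem subset_level {η : ℝ} (hη0 : 0 < η) (S : Finset ℕ)
    (hS : ∀ n ∈ S, (xs n ∈ F ∧ xs n ∈ Ioo (D'.mark 0) (D'.mark 0 + 1)) ∧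
      ∀ k < n, xs k ∈ F ∧ xs k ∈ Ioo (D'.mark 0) (D'.mark 0 + 1) →
        connectedComponentIn F (xs k) ≠ connectedComponentIn F (xs n)) :
    D'.carrier ⊆ D.carrier \ ⋃ n ∈ S, bite xs d η n ∧
      ∀ n (hn : (xs n ∈ F ∧ xs n ∈ Ioo (D'.mark 0) (D'.mark 0 + 1)) ∧
        ∀ k < n, xs k ∈ F ∧ xs k ∈ Ioo (D'.mark 0) (D'.mark 0 + 1) →
          connectedComponentIn F (xs k) ≠ connectedComponentIn F (xs n)),
        (d n hn.1).G '' {z : ℂ | ‖z‖ < 1 ∧ 0 < z.im ∧ z.im < η} ⊆ D.carrier \ ⋃ m ∈ S, bite xs d η m ∧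
        (n ∉ S → (d n hn.1).U ⊆ D.carrier \ ⋃ m ∈ S, bite xs d η m) := by
  have hmemU : ∀ m (hm : m ∈ S), ∀ w ∈ bite xs d η m, w ∈ closure (d m (hS m hm).1).U ∧
      w ≠ D'.boundary (sInf (connectedComponentIn F (xs m))) ∧
      w ≠ D'.boundary (sSup (connectedComponentIn F (xs m))) ∧ w ∉ closure D'.carrier := by
    intro m hm w hw
    obtain ⟨-, hsubm, hfm⟩ := bite_facts xs d hF hsub h0 h1 hη0 (hS m hm).1
    obtain ⟨hcl, hP, hQ⟩ := hfm w hw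
    exact ⟨hsubm hw, hP, hQ, hcl⟩
  -- a point of `U_n` (for a representative `n`) lies in no bite of another representative
  have hother : ∀ n (hn : (xs n ∈ F ∧ xs n ∈ Ioo (D'.mark 0) (D'.mark 0 + 1)) ∧
      ∀ k < n, xs k ∈ F ∧ xs k ∈ Ioo (D'.mark 0) (D'.mark 0 + 1) →
        connectedComponentIn F (xs k) ≠ connectedComponentIn F (xs n)),
      ∀ w ∈ (d n hn.1).U, ∀ m ∈ S, m ≠ n → w ∉ bite xs d η m := by
    intro n hn w hwU m hm hmn hw
    obtain ⟨hclm, hPm, hQm, -⟩ := hmemU m hm w hw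
    have hmem := (d m (hS m hm).1).closure_inter hF hsub h0 h1 (hS m hm).1.1 (hS m hm).1.2 hn.1.1 hn.1.2
      (rep_disjoint_components xs (hS m hm) hn hmn) (d n hn.1) ⟨hclm, subset_closure hwU⟩
    rcases hmem with h | h
    · exact hPm h
    · exact hQm h
  refine ⟨fun w hw ↦ ⟨hsub hw, ?_⟩, fun n hn ↦ ⟨?_, fun hnS w hwU ↦ ⟨(d n hn.1).U_subset hwU, ?_⟩⟩⟩
  · simp only [mem_iUnion, not_exists]
    intro m hm hwm
    exact (hmemU m hm w hwm).2.2.2 (subset_closure hw)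
  · rintro _ ⟨z, ⟨hz1, hz0, hzη⟩, rfl⟩
    have hwU : (d n hn.1).G z ∈ (d n hn.1).U := (d n hn.1).G_mem_U hz1 hz0
    refine ⟨(d n hn.1).U_subset hwU, ?_⟩
    simp only [mem_iUnion, not_exists]
    intro m hm hwm
    by_cases hmn : m = n
    · subst hmn
      rw [bite_eq xs d η hn.1] at hwm
      obtain ⟨z', ⟨-, hz'η⟩, hzz'⟩ := hwm
      have := (d m hn.1).G.injective hzz'
      rw [this] at hz'η
      linarith
    · exact hother n hn _ hwU m hm hmn hwm
  · simp only [mem_iUnion, not_exists]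
    intro m hm hwm
    exact hother n hn w hwU m hm (fun h ↦ hnS (h ▸ hm)) hwm

include hF hsub h0 h1 in
/-- **The loop lies on the frontier of the squeezed domain** (on the window). [folklore] -/
theorem loopΓ_mem_frontier {η : ℝ} (hη0 : 0 < η) (hη : η ≤ 1 / 4) (S : Finset ℕ)
    (hS : ∀ n ∈ S, (xs n ∈ F ∧ xs n ∈ Ioo (D'.mark 0) (D'.mark 0 + 1)) ∧
      ∀ k < n, xs k ∈ F ∧ xs k ∈ Ioo (D'.mark 0) (D'.mark 0 + 1) →
        connectedComponentIn F (xs k) ≠ connectedComponentIn F (xs n))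
    {y : ℝ} (hy : y ∈ Ico (D'.mark 0) (D'.mark 0 + 1)) :
    loopΓ xs d hex η S y ∈ frontier (D.carrier \ ⋃ n ∈ S, bite xs d η n) := by
  classical
  set V : Set ℂ := D.carrier \ ⋃ n ∈ S, bite xs d η n with hV
  have hVo : IsOpen V := by
    refine D.isOpen.sdiff (S.finite_toSet.isClosed_biUnion fun n hn ↦ ?_)
    exact (bite_facts xs d hF hsub h0 h1 hη0 (hS n hn).1).1
  obtain ⟨hD'V, hcollar⟩ := subset_level xs d hF hsub h0 h1 hη0 S hS
  rw [frontier, hVo.interior_eq]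
  by_cases h : y ∈ F ∧ y ∈ Ioo (D'.mark 0) (D'.mark 0 + 1)
  · obtain ⟨hgood, hcc, hmin⟩ := firstHit_spec xs hex h
    set n := Nat.find (hex y h) with hn_def
    have hrep : (xs n ∈ F ∧ xs n ∈ Ioo (D'.mark 0) (D'.mark 0 + 1)) ∧
        ∀ k < n, xs k ∈ F ∧ xs k ∈ Ioo (D'.mark 0) (D'.mark 0 + 1) →
          connectedComponentIn F (xs k) ≠ connectedComponentIn F (xs n) := ⟨hgood, hmin⟩
    set e := d n hgood with he
    have hxy : xs n ∈ connectedComponentIn F y := (Nat.find_spec (hex y h)).2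
    have hval : loopΓ xs d hex η S y = e.G (modelPath η S n (relPos F y)) :=
      loopΓ_eq xs d hex η S h hgood hxy fun k hk hk' hkm ↦ hmin k hk hk' ((connectedComponentIn_eq
          hkm).symm.trans hcc.symm)
    obtain ⟨-, -, hD, -⟩ := loopΓ_mem xs d hex hF hsub h0 h1 hη0 hη S h
    obtain ⟨hu, -⟩ := relPos_mem hF h0 h1 h
    obtain ⟨hle, hpos, -⟩ := modelPath_mem hη0 hη S n hu
    set pt := modelPath η S n (relPos F y) with hpt
    obtain ⟨hthin, huntreated⟩ := hcollar n hrep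
    constructor
    · -- in the closure of `V`
      rw [hval]
      by_cases hnS : n ∈ S
      · -- treated: approximate through the thin collar
        have him : pt.im ≤ η := by
          have : pt = pPar η (relPos F y) := by simp only [hpt, modelPath, if_pos hnS]
          rw [this]
          exact (norm_pPar hη0.le hη ⟨hu.1.le, hu.2.le⟩).2.2.2
        have hmem : pt ∈ closure {z : ℂ | ‖z‖ < 1 ∧ 0 < z.im ∧ z.im < η} :=
          mem_closure_thinCollar hη0 (by linarith) hle hpos.le him
        exact closure_mono hthin (image_closure_subset_closure_image e.G.continuous ⟨pt, hmem, rfl⟩)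
      · -- untreated: the whole defect side is in `V`
        exact closure_mono (huntreated hnS) (e.G_mem_closure hle hpos.le)
    · -- not in `V`
      intro hyV
      obtain ⟨hnS, himη, hlt1⟩ := hD hyV.1
      apply hyV.2
      simp only [mem_iUnion, exists_prop]
      refine ⟨n, hnS, ?_⟩
      rw [bite_eq xs d η hgood, hval]
      exact ⟨pt, ⟨hle, himη.ge⟩, rfl⟩
  · obtain ⟨-, hnotD, hcl⟩ := not_free_of_not hF h0 h1 hy h
    rw [loopΓ_of_not xs d hex η S h]
    exact ⟨closure_mono hD'V hcl, fun hV' ↦ hnotD hV'.1⟩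


end Level

/-- **Registered helper stub `stub_radoLevel`** (towards `stub_radoSqueezeFamily`, line `birth`): the model bite is
compact, in closed form. [folklore] -/
theorem stub_radoLevel : ∀ η : ℝ, IsCompact {z : ℂ | ‖z‖ ≤ 1 ∧ η ≤ z.im} :=
  fun η ↦ isCompact_modelBite η

end Summit.CriticalPhenomena.SAWScalingLimit.Theorems.RestrictionOfLimit.Birth

end
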